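/-
Copyright: rh-split cell, seat prover-l1 (L1/L19 «DUST WALL»), 2026-08-27.  ζ-free kernel theorem.
Nothing here bears on the truth of RH.
-/
import Summits.RiemannHypothesis.RiemannHypothesis.Theses.ScrewDustWall
import Summits.RiemannHypothesis.RiemannHypothesis.Theorems.Splittings.ScrewDustCellLimit
import Summits.RiemannHypothesis.RiemannHypothesis.Theorems.Splittings.ScrewDustZorettiHull
import HarnessLib

/-!
# Route `ScrewDustWall` (X-11 «DUST WALL»), crux `PointComponentInvisible` (stmt-RiemannHypothesis-21690) — closed

**Kernel theorem (RH-free, ζ-free).**  For a sign-definite ℓ¹ Borel family (`∑ ‖c i‖ < ∞`,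
`Re c i < 0`, `u i ≠ 0`) and `F` holomorphic on `𝔻` agreeing with the Borel series
`∑' i, term (c i) (u i)` on a pole-free disc `ball 0 r₀`: an inside pole `p` that is a POINT-COMPONENT of
the wall `closure (poleSet u) ∩ 𝔻` is never adherent to the connected component of `0` in
`𝔻 ∖ closure (poleSet u)`.

Proof = `ScrewDust.exists_small_cellComplex` (Zoretti hulls: arbitrarily small finite grid-cell
complexes around `p` whose exposed edges lie in the origin's component — Šura-Bura clopen pieces +
the tree's Janiszewski theorem; `Theorems/Splittings/ScrewDustZorettiHull.lean`) fed into
`ScrewDust.false_of_small_cellComplexes` (flux of the Borel series through grid cycles vanishes by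
Cauchy–Goursat + termwise residues on rectangles, while the enclosed charge tends to `p · C_p ≠ 0` by
Tannery; `Theorems/Splittings/ScrewDustCellLimit.lean`).  It generalises the §19 walls theorem
`ScrewBorel.not_mem_closure_of_isolated` (isolated poles) and the §20 circles theorem
`ScrewBorelFlux.false_of_small_circles`.

This is the provable content of the RH-equivalence X-11 (`CEIL(1) ∧ TD(1) ⟹ RH`); RH is not proved by
this file and nothing here bears on the truth of RH.
-/

set_option linter.dupNamespace false

namespace Summit.RiemannHypothesis.RiemannHypothesis.Theorems.Splittings.ScrewDust

open Complex Filter Topology Set Metric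
open Summit.RiemannHypothesis.RiemannHypothesis.Theorems.Splittings.ScrewBorel
open Summit.RiemannHypothesis.RiemannHypothesis.Theorems.Splittings.ScrewBorelFlux

/-- **Crux `PointComponentInvisible` (stmt-RiemannHypothesis-21690)** of route `ScrewDustWall`,
token-for-token the route decl: a pole that is a point-component of the wall is invisible from the
origin's component of the regular set.  [cite: PommerenkeBBCM1992, §1.1 (Janiszewski's Theorem)] -/
theorem PointComponentInvisible_proof :
    Summit.RiemannHypothesis.RiemannHypothesis.Theses.ScrewDustWall.PointComponentInvisible := by
  intro ι c u hc hre hu F hF r₀ hr₀ hS hFB p hp hcomp hadh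
  haveI : Countable ι := countable_of_summable_of_re_neg hc hre
  have hW : IsClosed (closure (poleSet u)) := isClosed_closure
  have h0W : (0 : ℂ) ∉ closure (poleSet u) := fun h ↦ by
    have hsub : closure (poleSet u) ⊆ {z : ℂ | r₀ ≤ ‖z‖} :=
      closure_minimal (fun q hq ↦ hS q hq) (isClosed_le continuous_const continuous_norm)
    have := hsub h
    rw [mem_setOf_eq, norm_zero] at this
    linarith
  have hT : {q : ℂ | ∃ i, q = u i ∨ q = (u i)⁻¹}.Countable := by
    have : {q : ℂ | ∃ i, q = u i ∨ q = (u i)⁻¹} ⊆ ⋃ i, {u i, (u i)⁻¹} := by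
      rintro q ⟨i, hq | hq⟩ <;> exact mem_iUnion.2 ⟨i, by simp [hq]⟩
    exact (countable_iUnion fun i ↦ (Set.toFinite _).countable).mono this
  have hpT : p ∈ {q : ℂ | ∃ i, q = u i ∨ q = (u i)⁻¹} := hp.2
  refine false_of_small_cellComplexes hc hre hu hF hr₀ hS hFB hp fun ε hε ↦ ?_
  obtain ⟨x, y, H, h1, h2, h3, h4, h5, h6, h7, h8, h9⟩ :=
    exists_small_cellComplex hW h0W hT (subset_closure hp) hp.1 hpT hcomp hadh hε
  exact ⟨x, y, H, h1, h2, h3, h4, fun i k hk q hq ↦ h5 q ⟨i, hq⟩ k hk, h6, h7, h8, h9⟩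

end Summit.RiemannHypothesis.RiemannHypothesis.Theorems.Splittings.ScrewDust
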